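import Summits.AtomisticToContinuum.BoseEinsteinCondensation.Theorems.BECGroundStateSOSPeriodicIRBoundFsumDefs
import Summits.AtomisticToContinuum.BoseEinsteinCondensation.Theorems.BECGroundStateSOSPeriodicIRBoundFsumDCAdjoint
import Summits.AtomisticToContinuum.BoseEinsteinCondensation.Theorems.BECGroundStateSOSPeriodicIRBoundWFHeartGlue
import HarnessLib

/-!
# Crux `PeriodicIRBound` (stmt-AtomisticToContinuum-3972), line `fsum-phase-pencil`, stub S3
# `stub_phaseDoubleCommutator` — part 2: the kinetic double commutator

For the condensate phase quadrature `U_k = T_{k0} − T_{0,−k}` (`phaseUp`, `T_{ab} = a_a† a_b = transfer L a b`)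
on core `(n+2)`-body functions:

* the kinetic polarised form `Re B_0` on `C¹` functions: `= ∫ kinCross`, additivity, `Re B_0(f, f) = T[f]`;
* adjointness `U_k† = −U_{−k}` (`innerRe_phaseUp_left`) and `‖U_kΨ‖² = −Re⟨U_{−k}U_kΨ, Ψ⟩`;
* the twisted kinetic adjointness `Re B_0(U_k g, Ψ) = −Re B_0(g, U_{−k}Ψ) + ε_k Re⟨g, P_k-type⟩`
  (`[T, U_k] = ε_k P_k` in the form sense, from `formRe_zero_transfer_left` of part 1);
* **the kinetic double commutator, exactly**:
  `T[U_kΨ] + T[U_{−k}Ψ] + Re B_0(U_{−k}U_kΨ, Ψ) + Re B_0(U_kU_{−k}Ψ, Ψ) = ε_k (2n_0 − n_k − n_{−k})(Ψ)`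
  (`‖T_{ab}Ψ‖² = n_b + ‖a_a a_bΨ‖²` and `[a_a, a_b] = 0`), whence the bound `≤ 2(n+2)‖k̃‖²‖Ψ‖²`
  (registered by-product sub-goal `stub_fsumDCKinetic`).
-/

noncomputable section

open MeasureTheory Filter
open scoped ENNReal NNReal ComplexConjugate BigOperators

namespace Summit.AtomisticToContinuum.BoseEinsteinCondensation.Cruxes.PeriodicIRBound.FsumPhasePencil

open Literature.MathematicalPhysics.QuantumManyBody.BoseGas
open Summit.AtomisticToContinuum.BoseEinsteinCondensation.Cruxes.PeriodicIRBound.LinearPhFloorWagner.WF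

variable {M n : ℕ} {L : ℝ}

/-! ## The kinetic polarised form on `C¹` functions -/

section FormReZero

variable {f g h : Config M → ℂ}

/-- `Re B_0(f, g) = ∫ kinCross f g` for `C¹` functions (no potential). [folklore] -/
theorem formRe_zero_eq_integral_kinCross (hf : ContDiff ℝ 1 f) (hg : ContDiff ℝ 1 g) :
    formRe 0 L f g = ∫ X in cellN M L, kinCross f g X := by
  rw [formRe_eq_integral_add (w := 0) measurable_const hf hg (by rw [potForm_zero]; exact ENNReal.zero_ne_top)
      (by rw [potForm_zero]; exact ENNReal.zero_ne_top)]
  simp only [periodicInteraction_zero, ENNReal.toReal_zero, zero_mul, integral_zero, add_zero]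

/-- `kinCross (f − g) h = kinCross f h − kinCross g h` at a point of differentiability. [folklore] -/
theorem kinCross_sub_left {X : Config M} (hf : DifferentiableAt ℝ f X) (hg : DifferentiableAt ℝ g X)
    (h : Config M → ℂ) : kinCross (fun Y => f Y - g Y) h X = kinCross f h X - kinCross g h X := by
  unfold kinCross
  rw [← Finset.sum_sub_distrib]
  refine Finset.sum_congr rfl fun i _ => ?_
  rw [← Finset.sum_sub_distrib]
  refine Finset.sum_congr rfl fun c _ => ?_
  rw [fderiv_fun_sub hf hg, FunLike.coe_sub, Pi.sub_apply, map_sub, sub_mul, Complex.sub_re]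

/-- `kinCross f f = |∇f|²`. [folklore] -/
theorem kinCross_self (f : Config M → ℂ) (X : Config M) : kinCross f f X = kineticDensityReal f X := by
  unfold kinCross kineticDensityReal
  refine Finset.sum_congr rfl fun i _ => Finset.sum_congr rfl fun c _ => ?_
  rw [Complex.conj_mul', ← Complex.ofReal_pow, Complex.ofReal_re]

/-- `Re B_0(f − g, h) = Re B_0(f, h) − Re B_0(g, h)` for `C¹` functions. [folklore] -/
theorem formRe_zero_sub_left (hf : ContDiff ℝ 1 f) (hg : ContDiff ℝ 1 g) (hh : ContDiff ℝ 1 h) :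
    formRe 0 L (fun X => f X - g X) h = formRe 0 L f h - formRe 0 L g h := by
  rw [formRe_zero_eq_integral_kinCross (hf.sub hg) hh, formRe_zero_eq_integral_kinCross hf hh,
    formRe_zero_eq_integral_kinCross hg hh,
    ← integral_sub (integrableOn_cellN (continuous_kinCross hf hh) L) (integrableOn_cellN (continuous_kinCross hg hh) L)]
  refine integral_congr_ae (Eventually.of_forall fun X => ?_)
  exact kinCross_sub_left ((hf.differentiable one_ne_zero) X) ((hg.differentiable one_ne_zero) X) h

/-- `Re B_0(f, g − h) = Re B_0(f, g) − Re B_0(f, h)` for `C¹` functions. [folklore] -/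
theorem formRe_zero_sub_right (hf : ContDiff ℝ 1 f) (hg : ContDiff ℝ 1 g) (hh : ContDiff ℝ 1 h) :
    formRe 0 L f (fun X => g X - h X) = formRe 0 L f g - formRe 0 L f h := by
  rw [formRe_comm, formRe_zero_sub_left hg hh hf, formRe_comm 0 L g f, formRe_comm 0 L h f]

/-- `Re B_0(f, f) = T[f]` for `C¹ f`. [folklore] -/
theorem formRe_zero_self (hf : ContDiff ℝ 1 f) : formRe 0 L f f = (qform 0 L f).toReal := by
  rw [formRe_zero_eq_integral_kinCross hf hf, qform_zero_eq, lintegral_kineticDensity_eq hf L,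
    ENNReal.toReal_ofReal (cellKineticEnergy_nonneg L f), cellKineticEnergy]
  exact integral_congr_ae (Eventually.of_forall fun X => kinCross_self f X)

end FormReZero

/-! ## The phase quadrature `U_k = T_{k0} − T_{0,−k}`: continuity, symmetry, adjointness -/

section PhaseUp

/-- Unfolding `phaseUp`. [folklore] -/
theorem phaseUp_eq (L : ℝ) (k : Fin 3 → ℤ) {N : ℕ} (Ψ : Config N → ℂ) :
    phaseUp L k Ψ = fun X => transfer L k 0 Ψ X - transfer L 0 (-k) Ψ X := rfl

/-- Unfolding `condUp`. [folklore] -/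
theorem condUp_eq (L : ℝ) (k : Fin 3 → ℤ) {N : ℕ} (Ψ : Config N → ℂ) :
    condUp L k Ψ = fun X => transfer L k 0 Ψ X + transfer L 0 (-k) Ψ X := rfl

/-- `U_kΨ` is continuous for continuous `Ψ`. [folklore] -/
theorem continuous_phaseUp (L : ℝ) (k : Fin 3 → ℤ) {Ψ : Config (n + 1) → ℂ} (hΨ : Continuous Ψ) :
    Continuous (phaseUp L k Ψ) :=
  (continuous_transfer L k 0 hΨ).sub (continuous_transfer L 0 (-k) hΨ)

/-- `U_kΨ` is Bose-symmetric for symmetric `Ψ`. [folklore] -/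
theorem isSymm_phaseUp (L : ℝ) (k : Fin 3 → ℤ) {Ψ : Config (n + 1) → ℂ} (hΨ : IsSymm Ψ) :
    IsSymm (phaseUp L k Ψ) := fun σ X => by
  simp only [phaseUp, isSymm_transfer L k 0 hΨ σ X, isSymm_transfer L 0 (-k) hΨ σ X]

/-- **Adjointness `U_k† = −U_{−k}`**: `Re⟨U_k g, Ψ⟩ = −Re⟨g, U_{−k} Ψ⟩` for continuous Bose-symmetric
`(n+1)`-body `g, Ψ`. [folklore] -/
theorem innerRe_phaseUp_left (k : Fin 3 → ℤ) {g Ψ : Config (n + 1) → ℂ} (hg : Continuous g) (hgs : IsSymm g)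
    (hΨ : Continuous Ψ) (hΨs : IsSymm Ψ) :
    innerRe L (phaseUp L k g) Ψ = -innerRe L g (phaseUp L (-k) Ψ) := by
  rw [phaseUp_eq, phaseUp_eq, neg_neg,
    innerRe_sub_left (continuous_transfer L k 0 hg) (continuous_transfer L 0 (-k) hg) hΨ,
    innerRe_sub_right hg (continuous_transfer L (-k) 0 hΨ) (continuous_transfer L 0 k hΨ),
    innerRe_transfer_left k 0 hg hgs hΨ hΨs, innerRe_transfer_left 0 (-k) hg hgs hΨ hΨs]
  ring

/-- `‖U_k Ψ‖² = −Re⟨U_{−k}(U_k Ψ), Ψ⟩` for a continuous Bose-symmetric `(n+1)`-body `Ψ`. [folklore] -/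
theorem normSq_phaseUp_eq_neg_innerRe (k : Fin 3 → ℤ) {Ψ : Config (n + 1) → ℂ} (hΨ : Continuous Ψ)
    (hΨs : IsSymm Ψ) :
    (normSq L (phaseUp L k Ψ)).toReal = -innerRe L (phaseUp L (-k) (phaseUp L k Ψ)) Ψ := by
  have hU := continuous_phaseUp L k hΨ
  have hUs := isSymm_phaseUp L k hΨs
  rw [← innerRe_self hU, innerRe_phaseUp_left (-k) hU hUs hΨ hΨs, neg_neg, neg_neg, innerRe_comm]

end PhaseUp

/-! ## The kinetic double commutator -/

section Kinetic

/-- **Twisted kinetic adjointness of `U_k`** (`[T, U_k] = ε_k P_k` in the form sense): for core `(n+2)`-body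
`g, Ψ`, `Re B_0(U_k g, Ψ) = −Re B_0(g, U_{−k} Ψ) + ε_k (Re⟨a_0 g, a_k Ψ⟩ + Re⟨a_{−k} g, a_0 Ψ⟩)`. [folklore] -/
theorem formRe_zero_phaseUp_left (hL : 0 < L) (k : Fin 3 → ℤ) {g Ψ : Config (n + 2) → ℂ} (hg : IsCore L g)
    (hΨ : IsCore L Ψ) :
    formRe 0 L (phaseUp L k g) Ψ = -formRe 0 L g (phaseUp L (-k) Ψ) +
      (eps L k).toReal * (innerRe L (modeAn L (planeWaveMode L 0) g) (modeAn L (planeWaveMode L k) Ψ) +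
        innerRe L (modeAn L (planeWaveMode L (-k)) g) (modeAn L (planeWaveMode L 0) Ψ)) := by
  have hT : ∀ a b, ∀ {f : Config (n + 2) → ℂ}, IsCore L f → ContDiff ℝ 1 (transfer L a b f) :=
    fun a b f hf => (isCore_modeCr hL a (isCore_modeAn hL b hf)).contDiff
  rw [phaseUp_eq, phaseUp_eq, neg_neg, formRe_zero_sub_left (hT k 0 hg) (hT 0 (-k) hg) hΨ.contDiff,
    formRe_zero_sub_right hg.contDiff (hT (-k) 0 hΨ) (hT 0 k hΨ),
    formRe_zero_transfer_left hL 0 k hg hΨ, formRe_zero_transfer_left hL (-k) 0 hg hΨ, eps_zero, eps_neg,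
    ENNReal.toReal_zero]
  ring

/-- `Re⟨U_k Ψ, P_k Ψ⟩ = ‖T_{k0}Ψ‖² − ‖T_{0,−k}Ψ‖²` (the cross terms cancel in the real part). [folklore] -/
theorem innerRe_phaseUp_condUp (k : Fin 3 → ℤ) {Ψ : Config (n + 1) → ℂ} (hΨ : Continuous Ψ) :
    innerRe L (phaseUp L k Ψ) (condUp L k Ψ) =
      (normSq L (transfer L k 0 Ψ)).toReal - (normSq L (transfer L 0 (-k) Ψ)).toReal := by
  have h1 := continuous_transfer L k 0 hΨ
  have h2 := continuous_transfer L 0 (-k) hΨ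
  rw [phaseUp_eq, condUp_eq,
    innerRe_sub_left h1 h2 (show Continuous (fun X => transfer L k 0 Ψ X + transfer L 0 (-k) Ψ X) from h1.add h2),
    innerRe_add_right h1 h1 h2,
    innerRe_add_right h2 h1 h2, innerRe_self h1, innerRe_self h2, innerRe_comm L (transfer L 0 (-k) Ψ)]
  ring

/-- **Half of the kinetic double commutator**: for a core `(n+2)`-body `Ψ`,
`Re B_0(U_{−k}(U_k Ψ), Ψ) = −T[U_k Ψ] + ε_k (‖T_{k0}Ψ‖² − ‖T_{0,−k}Ψ‖²)`. [folklore] -/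
theorem formRe_zero_phaseUp_phaseUp (hL : 0 < L) (k : Fin 3 → ℤ) {Ψ : Config (n + 2) → ℂ} (hΨ : IsCore L Ψ)
    (hU : IsCore L (phaseUp L k Ψ)) :
    formRe 0 L (phaseUp L (-k) (phaseUp L k Ψ)) Ψ = -(qform 0 L (phaseUp L k Ψ)).toReal +
      (eps L k).toReal * ((normSq L (transfer L k 0 Ψ)).toReal - (normSq L (transfer L 0 (-k) Ψ)).toReal) := by
  have hΨc := hΨ.contDiff.continuous
  have hUc := hU.contDiff.continuous
  rw [formRe_zero_phaseUp_left hL (-k) hU hΨ, neg_neg, eps_neg, formRe_zero_self hU.contDiff,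
    innerRe_modeAn_modeAn 0 (-k) hUc hU.symm hΨc, innerRe_modeAn_modeAn k 0 hUc hU.symm hΨc,
    ← innerRe_phaseUp_condUp k hΨc, condUp_eq,
    innerRe_add_right hUc (continuous_transfer L k 0 hΨc) (continuous_transfer L 0 (-k) hΨc)]
  ring

/-- `‖T_{ab} Ψ‖² = n_b(Ψ) + ‖a_a a_b Ψ‖²` for a core `(n+2)`-body `Ψ` (`‖a†Φ‖² = ‖Φ‖² + ‖aΦ‖²`). [folklore] -/
theorem toReal_normSq_transfer (hL : 0 < L) (a b : Fin 3 → ℤ) {Ψ : Config (n + 2) → ℂ} (hΨ : IsCore L Ψ) :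
    (normSq L (transfer L a b Ψ)).toReal = (normSq L (modeAn L (planeWaveMode L b) Ψ)).toReal +
      (normSq L (modeAn L (planeWaveMode L a) (modeAn L (planeWaveMode L b) Ψ))).toReal := by
  have hb := isCore_modeAn hL b hΨ
  rw [transfer_succ, normSq_modeCr hL a hb, ← normSq_modeAn hL a,
    ENNReal.toReal_add (normSq_ne_top L hb.contDiff.continuous) (normSq_ne_top L (isCore_modeAn hL a hb).contDiff.continuous)]

/-- **The kinetic double commutator, exactly**: for a core `(n+2)`-body `Ψ` and every mode `k`,
`T[U_kΨ] + T[U_{−k}Ψ] + Re B_0(U_{−k}U_kΨ, Ψ) + Re B_0(U_kU_{−k}Ψ, Ψ) = ε_k (2n_0(Ψ) − n_k(Ψ) − n_{−k}(Ψ))`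
(`½⟨[U_k†,[T,U_k]] + h.c.⟩ = ε_k⟨[U_k†, P_k]⟩`, `[U_k†, P_k] = 2n̂_0 − n̂_k − n̂_{−k}`). [folklore] -/
theorem kinetic_doubleCommutator_eq (hL : 0 < L) (k : Fin 3 → ℤ) {Ψ : Config (n + 2) → ℂ} (hΨ : IsCore L Ψ)
    (hU : IsCore L (phaseUp L k Ψ)) (hU' : IsCore L (phaseUp L (-k) Ψ)) :
    (qform 0 L (phaseUp L k Ψ)).toReal + (qform 0 L (phaseUp L (-k) Ψ)).toReal +
        formRe 0 L (phaseUp L (-k) (phaseUp L k Ψ)) Ψ + formRe 0 L (phaseUp L k (phaseUp L (-k) Ψ)) Ψ =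
      ‖waveVector L k‖ ^ 2 * (2 * (normSq L (modeAn L (planeWaveMode L 0) Ψ)).toReal -
        (normSq L (modeAn L (planeWaveMode L k) Ψ)).toReal - (normSq L (modeAn L (planeWaveMode L (-k)) Ψ)).toReal) := by
  have h1 := formRe_zero_phaseUp_phaseUp hL k hΨ hU
  have h2 := formRe_zero_phaseUp_phaseUp hL (-k) hΨ hU'
  rw [neg_neg, eps_neg] at h2
  rw [h1, h2, toReal_normSq_transfer hL k 0 hΨ, toReal_normSq_transfer hL 0 (-k) hΨ,
    toReal_normSq_transfer hL (-k) 0 hΨ, toReal_normSq_transfer hL 0 k hΨ,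
    modeAn_modeAn_planeWaveMode_comm k 0 hΨ.contDiff.continuous hΨ.symm,
    modeAn_modeAn_planeWaveMode_comm (-k) 0 hΨ.contDiff.continuous hΨ.symm, toReal_eps_eq]
  ring

/-- **The kinetic double commutator bound** `𝒦 ≤ 2 ε_k n_0(Ψ) ≤ 2 (n+2) ‖k̃‖² ‖Ψ‖²` for a core `(n+2)`-body `Ψ`.
[folklore] -/
theorem kinetic_doubleCommutator_le (hL : 0 < L) (k : Fin 3 → ℤ) {Ψ : Config (n + 2) → ℂ} (hΨ : IsCore L Ψ)
    (hU : IsCore L (phaseUp L k Ψ)) (hU' : IsCore L (phaseUp L (-k) Ψ)) :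
    (qform 0 L (phaseUp L k Ψ)).toReal + (qform 0 L (phaseUp L (-k) Ψ)).toReal +
        formRe 0 L (phaseUp L (-k) (phaseUp L k Ψ)) Ψ + formRe 0 L (phaseUp L k (phaseUp L (-k) Ψ)) Ψ ≤
      2 * (n + 2) * ‖waveVector L k‖ ^ 2 * (normSq L Ψ).toReal := by
  rw [kinetic_doubleCommutator_eq hL k hΨ hU hU']
  have hΨc := hΨ.contDiff.continuous
  have h0 : (normSq L (modeAn L (planeWaveMode L 0) Ψ)).toReal ≤ (n + 2) * (normSq L Ψ).toReal := by
    have h := cellOccupation_le_mul_normSq hL 0 hΨc (M := n + 2)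
    rw [← normSq_modeAn hL 0 Ψ] at h
    have h' := ENNReal.toReal_mono (ENNReal.mul_ne_top (by simp) (normSq_ne_top L hΨc)) h
    rw [ENNReal.toReal_mul] at h'
    push_cast at h'
    exact h'
  have hk : 0 ≤ (normSq L (modeAn L (planeWaveMode L k) Ψ)).toReal := ENNReal.toReal_nonneg
  have hk' : 0 ≤ (normSq L (modeAn L (planeWaveMode L (-k)) Ψ)).toReal := ENNReal.toReal_nonneg
  have hε : 0 ≤ ‖waveVector L k‖ ^ 2 := sq_nonneg _
  nlinarith [mul_le_mul_of_nonneg_left h0 hε, mul_nonneg hε hk, mul_nonneg hε hk']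

/-- **Registered by-product sub-goal `stub_fsumDCKinetic`** (line `fsum-phase-pencil`, helper of S3
`stub_phaseDoubleCommutator`): the kinetic double commutator bound `kinetic_doubleCommutator_le`. [folklore] -/
theorem stub_fsumDCKinetic : ∀ {n : ℕ} {L : ℝ}, 0 < L → ∀ (k : Fin 3 → ℤ) {Ψ : Config (n + 2) → ℂ}, IsCore L Ψ → IsCore L (phaseUp L k Ψ) → IsCore L (phaseUp L (-k) Ψ) → (qform 0 L (phaseUp L k Ψ)).toReal + (qform 0 L (phaseUp L (-k) Ψ)).toReal + formRe 0 L (phaseUp L (-k) (phaseUp L k Ψ)) Ψ + formRe 0 L (phaseUp L k (phaseUp L (-k) Ψ)) Ψ ≤ 2 * (n + 2) * ‖waveVector L k‖ ^ 2 * (normSq L Ψ).toReal :=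
  fun hL k _ hΨ hU hU' => kinetic_doubleCommutator_le hL k hΨ hU hU'

end Kinetic

end Summit.AtomisticToContinuum.BoseEinsteinCondensation.Cruxes.PeriodicIRBound.FsumPhasePencil

end
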